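import Summits.Ventures.PercRepro.PerFlatTransfer

/-!
# PercRepro — the per-flat route of C-025 is EXACTLY a Hall condition on the rank-`q` flats, part A: the condition
and the easy direction (night-4, gen 2; part B = `PerFlatHallMarriage.lean`)

`PerFlatTransfer.lean` (p2) shows that ANY weighting `w(G, S)` of the rank-`q` flats `G` by the middle-level sets `S`
with `Σ_G w(G, S) ≤ 1` and the per-flat inequality `c · #U_G ≤ Σ_S w(G, S)` gives `c · #U ≤ #Y`, i.e. C-025's core
at `(p, q)` with `c = Φ(p, q)`.  Every rule the cell has used (pair rule, max-trace, soft max-trace, hard max-trace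
`fHardQ`, the `R_q` rule) is SUPPORTED ON ADJACENCY: `w(G, S) = 0` unless the trace `S ∩ G` has rank `q` (`G` is the
closure of a hyperplane of `M|S`).  This file characterises what such certificates can prove:

* `Adj M q G S` — the trace `S ∩ G` has rank `q`; `nbhd M p q 𝒢` — the middle-level sets adjacent to some flat of the
  family `𝒢`; `UqFam M p q 𝒢` — the bottom sets whose closure lies in `𝒢`;
* **`Hall M p q c`** — for EVERY family `𝒢` of rank-`q` flats, `c · #UqFam(𝒢) ≤ #nbhd(𝒢)`;
* `IsCert M p q c w` — a nonnegative weighting supported on adjacency (on the rank-`q` flats) with `Σ_G w ≤ 1` and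
  the per-flat inequality;
* `hall_of_cert`: a certificate gives the Hall condition (sum the per-flat inequalities over `𝒢`);
* `c025_of_hall`: the Hall condition at `𝒢 = ` all rank-`q` flats is C-025's core itself.
The converse — the Hall condition GIVES a certificate (Mathlib's marriage theorem on `a` copies of every bottom set
and `b` copies of every middle-level set), so that the two are EQUIVALENT — is `PerFlatHallMarriage.lean`.

So the «existence form» of the per-flat certificate (mine-2's §18.3, the proof route of record for C-025's core) is
the statement `Hall M p q (Φ p q)` — a Hall condition over sub-families of flats, a strict strengthening of C-025 that
can be tested by a max-flow on any finite matroid — and any fixed rule (hard max-trace included) can only prove C-025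
on the matroids where this Hall condition holds.  Imports: p2's `PerFlatTransfer` only.
-/

namespace PercRepro.PerFlat

open Finset ThmH

variable {α : Type*} [DecidableEq α] {M : Matroid α} [M.Finite]

/-! ## Adjacency, neighbourhoods, the bottom sets of a family -/

/-- A rank-`q` flat `G` is ADJACENT to `S` when the trace `S ∩ G` has rank `q`. -/
def Adj (M : Matroid α) [M.Finite] (q : ℕ) (G S : Finset α) : Prop :=
  M.eRk ((S ∩ G : Finset α) : Set α) = (q : ℕ∞)

open scoped Classical in
/-- The middle-level sets adjacent to some flat of the family `𝒢`. -/
noncomputable def nbhd (M : Matroid α) [M.Finite] (p q : ℕ) (𝒢 : Finset (Finset α)) : Finset (Finset α) :=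
  (Yq M p q).filter (fun S => ∃ G ∈ 𝒢, Adj M q G S)

open scoped Classical in
/-- The bottom sets whose closure lies in the family `𝒢`. -/
noncomputable def UqFam (M : Matroid α) [M.Finite] (p q : ℕ) (𝒢 : Finset (Finset α)) : Finset (Finset α) :=
  (Uq M p q).filter (fun B => clF M B ∈ 𝒢)

open scoped Classical in
/-- Membership in `nbhd`. -/
theorem mem_nbhd {p q : ℕ} {𝒢 : Finset (Finset α)} {S : Finset α} :
    S ∈ nbhd M p q 𝒢 ↔ S ∈ Yq M p q ∧ ∃ G ∈ 𝒢, Adj M q G S := by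
  unfold nbhd
  rw [Finset.mem_filter]

open scoped Classical in
/-- Membership in `UqFam`. -/
theorem mem_UqFam {p q : ℕ} {𝒢 : Finset (Finset α)} {B : Finset α} :
    B ∈ UqFam M p q 𝒢 ↔ B ∈ Uq M p q ∧ clF M B ∈ 𝒢 := by
  unfold UqFam
  rw [Finset.mem_filter]

/-- `nbhd ⊆ Yq`. -/
theorem nbhd_subset {p q : ℕ} (𝒢 : Finset (Finset α)) : nbhd M p q 𝒢 ⊆ Yq M p q :=
  fun _ hS => (mem_nbhd.1 hS).1

/-- For a bottom set `B` and a rank-`q` flat `G`: `B ⊆ G` iff `cl(B) = G`. -/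
theorem subset_iff_clF_eq {p q : ℕ} {B G : Finset α} (hB : B ∈ Uq M p q) (hG : G ∈ flatsQ M q) :
    B ⊆ G ↔ clF M B = G := by
  constructor
  · intro hBG
    obtain ⟨-, hGflat, hGr⟩ := mem_flatsQ.1 hG
    have hBr := (mem_Uq.1 hB).2.1
    apply Finset.coe_injective
    rw [coe_clF]
    exact closure_eq_of_subset_flat hGflat (Finset.coe_subset.2 hBG) B.finite_toSet (by rw [hGr, hBr])
  · intro h
    rw [← h]
    exact subset_clF hB

/-- `UqG M p q G = {B ∈ Uq : cl(B) = G}` for a rank-`q` flat `G`. -/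
theorem UqG_eq_filter_clF {p q : ℕ} {G : Finset α} (hG : G ∈ flatsQ M q) :
    UqG M p q G = (Uq M p q).filter (fun B => clF M B = G) := by
  ext B
  unfold UqG
  rw [Finset.mem_filter, Finset.mem_filter]
  constructor
  · rintro ⟨hB, hBG⟩
    exact ⟨hB, (subset_iff_clF_eq hB hG).1 hBG⟩
  · rintro ⟨hB, h⟩
    exact ⟨hB, (subset_iff_clF_eq hB hG).2 h⟩

/-- `UqFam(flatsQ) = Uq`: every bottom set has a rank-`q` flat as its closure. -/
theorem UqFam_flatsQ (p q : ℕ) : UqFam M p q (flatsQ M q) = Uq M p q := by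
  ext B
  rw [mem_UqFam]
  exact ⟨fun h => h.1, fun h => ⟨h, clF_mem_flatsQ h⟩⟩

/-- `nbhd(flatsQ) = Yq`: every middle-level set is adjacent to the closure of a rank-`q` subset of itself. -/
theorem nbhd_flatsQ (p q : ℕ) : nbhd M p q (flatsQ M q) = Yq M p q := by
  ext S
  rw [mem_nbhd]
  refine ⟨fun h => h.1, fun hS => ⟨hS, ?_⟩⟩
  obtain ⟨hSE, hq, -⟩ := (show S ∈ Yq M p q ↔ _ from by unfold Yq; rw [Finset.mem_filter, Finset.mem_powerset]).1 hS
  -- a rank-`q` subset `T ⊆ S` exists (`q < ρ(S)`); its closure is adjacent to `S`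
  have hSE' : (S : Set α) ⊆ M.E := by rw [← coe_gr]; exact_mod_cast hSE
  obtain ⟨I, hI⟩ := M.exists_isBasis (S : Set α) hSE'
  have hIcard : (q : ℕ∞) < I.encard := by rw [hI.encard_eq_eRk]; exact hq
  have hIfin : I.Finite := S.finite_toSet.subset hI.subset
  obtain ⟨T, hTI, hTcard⟩ := Set.exists_subset_encard_eq (show (q : ℕ∞) ≤ I.encard from hIcard.le)
  have hTfin : T.Finite := hIfin.subset hTI
  have hTind : M.Indep T := hI.indep.subset hTI
  have hTr : M.eRk T = (q : ℕ∞) := by rw [hTind.eRk_eq_encard, hTcard]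
  refine ⟨clF M hTfin.toFinset, ?_, ?_⟩
  · rw [mem_flatsQ, ← Finset.coe_subset, coe_clF, coe_gr, Set.Finite.coe_toFinset]
    exact ⟨M.closure_subset_ground _, M.isFlat_closure _, by rw [M.eRk_closure_eq, hTr]⟩
  · unfold Adj
    apply le_antisymm
    · calc M.eRk ((S ∩ clF M hTfin.toFinset : Finset α) : Set α)
          ≤ M.eRk ((clF M hTfin.toFinset : Finset α) : Set α) := M.eRk_mono (by
            rw [Finset.coe_subset]; exact Finset.inter_subset_right)
        _ = (q : ℕ∞) := by rw [coe_clF, Set.Finite.coe_toFinset, M.eRk_closure_eq, hTr]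
    · calc (q : ℕ∞) = M.eRk T := hTr.symm
        _ ≤ M.eRk ((S ∩ clF M hTfin.toFinset : Finset α) : Set α) := M.eRk_mono (by
            rw [Finset.coe_inter, coe_clF, Set.Finite.coe_toFinset]
            exact Set.subset_inter (hTI.trans hI.subset) (M.subset_closure T (hTind.subset_ground)))

/-! ## The Hall condition and the certificates -/

/-- **The Hall condition of the per-flat route**: for every family `𝒢` of rank-`q` flats, `c · #UqFam(𝒢) ≤ #nbhd(𝒢)`. -/
def Hall (M : Matroid α) [M.Finite] (p q : ℕ) (c : ℚ) : Prop :=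
  ∀ 𝒢 ⊆ flatsQ M q, c * ((UqFam M p q 𝒢).card : ℚ) ≤ ((nbhd M p q 𝒢).card : ℚ)

/-- **A per-flat certificate**: a nonnegative weighting of the rank-`q` flats by the middle-level sets, supported on
adjacency, with `Σ_G w(G, S) ≤ 1` and the per-flat inequality `c · #U_G ≤ Σ_S w(G, S)`. -/
structure IsCert (M : Matroid α) [M.Finite] (p q : ℕ) (c : ℚ) (w : Finset α → Finset α → ℚ) : Prop where
  nonneg : ∀ G S, 0 ≤ w G S
  support : ∀ G ∈ flatsQ M q, ∀ S, ¬ Adj M q G S → w G S = 0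
  sum_le_one : ∀ S ∈ Yq M p q, ∑ G ∈ flatsQ M q, w G S ≤ 1
  perFlat : ∀ G ∈ flatsQ M q, c * ((UqG M p q G).card : ℚ) ≤ ∑ S ∈ Yq M p q, w G S

/-- A certificate gives C-025's core (`PerFlatTransfer.c025_of_perFlat`). -/
theorem c025_of_cert {p q : ℕ} {c : ℚ} (hc : 0 ≤ c) {w : Finset α → Finset α → ℚ} (h : IsCert M p q c w) :
    c * ({A : Set α | A ⊆ M.E ∧ M.eRk A = (p : ℕ∞) ∧ M.eRk (M.E \ A) = (q : ℕ∞)}.ncard : ℚ) ≤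
      ({A : Set α | A ⊆ M.E ∧ (q : ℕ∞) < M.eRk A ∧ M.eRk A < (p : ℕ∞)}.ncard : ℚ) :=
  c025_of_perFlat M p q hc w h.sum_le_one h.perFlat

/-- `#UqFam(𝒢) ≤ Σ_{G ∈ 𝒢} #UqG(G)` (fibres of the closure map). -/
theorem card_UqFam_le {p q : ℕ} {𝒢 : Finset (Finset α)} (h𝒢 : 𝒢 ⊆ flatsQ M q) :
    (UqFam M p q 𝒢).card ≤ ∑ G ∈ 𝒢, (UqG M p q G).card := by
  rw [Finset.card_eq_sum_card_fiberwise (f := fun B => clF M B) (t := 𝒢)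
    (fun B hB => (mem_UqFam.1 hB).2)]
  apply Finset.sum_le_sum
  intro G hG
  apply Finset.card_le_card
  intro B hB
  rw [Finset.mem_filter, mem_UqFam] at hB
  rw [UqG_eq_filter_clF (h𝒢 hG), Finset.mem_filter]
  exact ⟨hB.1.1, hB.2⟩

/-- **A certificate gives the Hall condition**: sum the per-flat inequalities over the family. -/
theorem hall_of_cert {p q : ℕ} {c : ℚ} (hc : 0 ≤ c) {w : Finset α → Finset α → ℚ} (h : IsCert M p q c w) :
    Hall M p q c := by
  intro 𝒢 h𝒢
  calc c * ((UqFam M p q 𝒢).card : ℚ)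
      ≤ c * ((∑ G ∈ 𝒢, (UqG M p q G).card : ℕ) : ℚ) := by
        apply mul_le_mul_of_nonneg_left _ hc
        exact_mod_cast card_UqFam_le h𝒢
    _ = ∑ G ∈ 𝒢, c * ((UqG M p q G).card : ℚ) := by
        push_cast
        rw [Finset.mul_sum]
    _ ≤ ∑ G ∈ 𝒢, ∑ S ∈ Yq M p q, w G S := Finset.sum_le_sum (fun G hG => h.perFlat G (h𝒢 hG))
    _ = ∑ S ∈ Yq M p q, ∑ G ∈ 𝒢, w G S := Finset.sum_comm
    _ = ∑ S ∈ nbhd M p q 𝒢, ∑ G ∈ 𝒢, w G S := by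
        symm
        apply Finset.sum_subset (nbhd_subset 𝒢)
        intro S hS hSn
        apply Finset.sum_eq_zero
        intro G hG
        apply h.support G (h𝒢 hG)
        intro hadj
        exact hSn (mem_nbhd.2 ⟨hS, G, hG, hadj⟩)
    _ ≤ ∑ S ∈ nbhd M p q 𝒢, ∑ G ∈ flatsQ M q, w G S := by
        apply Finset.sum_le_sum
        intro S _
        exact Finset.sum_le_sum_of_subset_of_nonneg h𝒢 (fun G _ _ => h.nonneg G S)
    _ ≤ ∑ S ∈ nbhd M p q 𝒢, (1 : ℚ) :=
        Finset.sum_le_sum (fun S hS => h.sum_le_one S (nbhd_subset 𝒢 hS))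
    _ = ((nbhd M p q 𝒢).card : ℚ) := by simp

/-- **The Hall condition gives C-025's core** (take `𝒢 = ` all the rank-`q` flats). -/
theorem c025_of_hall {p q : ℕ} {c : ℚ} (h : Hall M p q c) :
    c * ({A : Set α | A ⊆ M.E ∧ M.eRk A = (p : ℕ∞) ∧ M.eRk (M.E \ A) = (q : ℕ∞)}.ncard : ℚ) ≤
      ({A : Set α | A ⊆ M.E ∧ (q : ℕ∞) < M.eRk A ∧ M.eRk A < (p : ℕ∞)}.ncard : ℚ) := by
  have h' := h (flatsQ M q) (Finset.Subset.refl _)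
  rw [UqFam_flatsQ, nbhd_flatsQ] at h'
  rw [ncard_Y_eq_card_Yq]
  by_cases hc : 0 ≤ c
  · calc c * ({A : Set α | A ⊆ M.E ∧ M.eRk A = (p : ℕ∞) ∧ M.eRk (M.E \ A) = (q : ℕ∞)}.ncard : ℚ)
        ≤ c * ((Uq M p q).card : ℚ) := by
          apply mul_le_mul_of_nonneg_left _ hc
          exact_mod_cast ncard_U_le_card_Uq M p q
      _ ≤ ((Yq M p q).card : ℚ) := h'
  · push Not at hc
    have h1 : c * ({A : Set α | A ⊆ M.E ∧ M.eRk A = (p : ℕ∞) ∧ M.eRk (M.E \ A) = (q : ℕ∞)}.ncard : ℚ) ≤ 0 :=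
      mul_nonpos_of_nonpos_of_nonneg hc.le (by positivity)
    have h2 : (0 : ℚ) ≤ ((Yq M p q).card : ℚ) := by positivity
    linarith

end PercRepro.PerFlat
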